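import Summits.QuantumFields.YangMills.Theorems.ColdStartUniversalityColdStartSolutionsExistTangentTools
import Literature.Probability.Process.ItoIntegralConstruction
import HarnessLib

/-!
# Route `ColdStartUniversality`, support item S (stmt-QuantumFields-24811), line `piwiener`:
# stub B tools III — dyadic sampling error in `L²(ds ⊗ P)`; the sampling-error martingale `J − σₙ·B`

Helper file (lead `ym-line-csu-p1`) for stub B1 `stub_tangentSumSq`.  For a progressive integrand `σ` with
a.s. continuous paths and square-integrable running suprema, the dyadic sampled step processes
`σₙ = sample σ n` (tree `SimpleProcess.sample`: grid `k/2ⁿ` on `[0, n]`, values clamped to `[−n, n]`)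
satisfy `E ∫₀ᵗ (σ − σₙ)² ds → 0` (`sqErr_sample_tendsto_zero`; pathwise `tendsto_lintegral_sample_sub_sq` +
dominated convergence).  Consequently, for `J = ∫ σ dB` (square-integrable martingale version) the
SAMPLING-ERROR MARTINGALE `Ĩ = J − σₙ·B` has `E[sup_{s≤t} Ĩ_s²] ≤ 4 E∫₀ᵗ (σ − σₙ)² → 0`
(`lintegral_iSup_samplingErr_sq_le`), is a square-integrable martingale (`martingale_samplingErr`), and
Riemann–Stieltjes sums of bounded predictable weights against it, as well as its quadratic sums over any
grid, are small in `L²` / `L¹` (`integral_sq_simple_integral_samplingErr_le`,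
`integral_quadSum_samplingErr_le`).

No definition, no sorry.  RECORD-rung plumbing; nothing here bears on the Yang–Mills mass gap. -/

set_option autoImplicit false

noncomputable section

namespace Summit.QuantumFields.YangMills.Theorems.ColdStartUniversality

open MeasureTheory ProbabilityTheory Filter Topology Finset
open scoped NNReal ENNReal BigOperators
open Literature.Probability.Process

variable {Ω : Type*} {m : MeasurableSpace Ω} {𝓕 : Filtration ℝ≥0 m} {μ : Measure Ω}

/-- **Dyadic sampling approximates a continuous square-integrable integrand in `L²(ds ⊗ P)`**:
`E ∫₀ᵗ (σ − sample σ n)² ds → 0` for `σ` progressive with a.s. continuous paths and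
`E[sup_{s≤t} σ_s²] < ∞` (pathwise uniform continuity, dominated convergence with `4 t sup σ²`).
Revuz–Yor (1999), Ch. IV, proof of Prop. (2.13). [folklore] -/
theorem sqErr_sample_tendsto_zero [IsFiniteMeasure μ] {σ : ℝ≥0 → Ω → ℝ} (hσ : IsStronglyProgressive 𝓕 σ)
    (hσa : Adapted 𝓕 σ)
    (hσc : ∀ᵐ ω ∂μ, Continuous fun s => σ s ω)
    (hσsup : ∀ t : ℝ≥0, ∫⁻ ω, ⨆ s ∈ Set.Iic t, ENNReal.ofReal (σ s ω ^ 2) ∂μ < ⊤) (t : ℝ≥0) :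
    Tendsto (fun n => sqErr σ (SimpleProcess.sample σ hσa n).toProcess μ t) atTop (𝓝 0) := by
  have hσm := measurable_toNNReal_of_isStronglyProgressive hσ
  -- the inner integrals
  set F : ℕ → Ω → ℝ≥0∞ := fun n ω => ∫⁻ s in Set.Icc (0 : ℝ) t,
    ENNReal.ofReal (((SimpleProcess.sample σ hσa n).toProcess s.toNNReal ω - σ s.toNNReal ω) ^ 2) with hF
  have hFm : ∀ n, Measurable (F n) := fun n =>
    measurable_lintegral_sqErr (SimpleProcess.sample σ hσa n).measurable_toProcess_prod hσm t
  have hsqErr : ∀ n, sqErr σ (SimpleProcess.sample σ hσa n).toProcess μ t = ∫⁻ ω, F n ω ∂μ := by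
    intro n; rw [sqErr_comm]; rfl
  simp_rw [hsqErr]
  -- domination by `4 t sup σ²`
  set G : Ω → ℝ≥0∞ := fun ω => 4 * (⨆ s ∈ Set.Iic t, ENNReal.ofReal (σ s ω ^ 2)) * volume (Set.Icc (0 : ℝ) t)
    with hG
  have hbound : ∀ n, ∀ᵐ ω ∂μ, F n ω ≤ G ω := by
    intro n
    refine ae_of_all _ fun ω => ?_
    simp only [hF, hG]
    rw [← setLIntegral_const]
    refine setLIntegral_mono' measurableSet_Icc fun s hs => ?_
    have hst : s.toNNReal ∈ Set.Iic t := Real.toNNReal_le_iff_le_coe.2 hs.2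
    -- `|sample| ≤ |σ (sampleLeft)|` or `0`; both are `≤ sup`
    have hsamp : ENNReal.ofReal ((SimpleProcess.sample σ hσa n).toProcess s.toNNReal ω ^ 2) ≤
        ⨆ r ∈ Set.Iic t, ENNReal.ofReal (σ r ω ^ 2) := by
      by_cases h0 : 0 < s.toNNReal ∧ s.toNNReal ≤ n
      · have hle := SimpleProcess.abs_toProcess_sample_le σ hσa h0.1 h0.2 ω
        have hleft : sampleLeft n s.toNNReal ∈ Set.Iic t := (sampleLeft_le h0.1).trans hst
        refine le_trans (ENNReal.ofReal_le_ofReal ?_) (le_iSup₂_of_le (sampleLeft n s.toNNReal) hleft le_rfl)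
        rw [← sq_abs, ← sq_abs (σ _ ω)]
        exact pow_le_pow_left₀ (abs_nonneg _) hle 2
      · have hz : (SimpleProcess.sample σ hσa n).toProcess s.toNNReal ω = 0 := by
          refine (SimpleProcess.sample σ hσa n).toProcess_eq_zero_of_forall (fun i hi hmem => h0 ?_) ω
          refine ⟨lt_of_le_of_lt bot_le hmem.1, hmem.2.trans ?_⟩
          rw [SimpleProcess.sample_time σ hσa n (by simpa using hi)]
          have : ((i + 1 : ℕ) : ℝ≥0) / 2 ^ n ≤ (n * 2 ^ n : ℕ) / 2 ^ n := by
            gcongr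
            have : i + 1 < (SimpleProcess.sample σ hσa n).times.length := hi
            simp only [SimpleProcess.sample_times, length_dyadicTimes] at this
            exact_mod_cast (by omega : i + 1 ≤ n * 2 ^ n)
          refine this.trans (le_of_eq ?_)
          rw [Nat.cast_mul, Nat.cast_pow, Nat.cast_ofNat, mul_div_assoc, div_self (pow_ne_zero _ two_ne_zero),
            mul_one]
        rw [hz]
        simp only [ne_eq, OfNat.ofNat_ne_zero, not_false_eq_true, zero_pow, ENNReal.ofReal_zero]
        exact bot_le
    have hσle : ENNReal.ofReal (σ s.toNNReal ω ^ 2) ≤ ⨆ r ∈ Set.Iic t, ENNReal.ofReal (σ r ω ^ 2) :=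
      le_iSup₂_of_le s.toNNReal hst le_rfl
    calc ENNReal.ofReal (((SimpleProcess.sample σ hσa n).toProcess s.toNNReal ω - σ s.toNNReal ω) ^ 2)
        ≤ ENNReal.ofReal (2 * σ s.toNNReal ω ^ 2 +
            2 * (SimpleProcess.sample σ hσa n).toProcess s.toNNReal ω ^ 2) := by
          refine ENNReal.ofReal_le_ofReal ?_
          nlinarith [sq_nonneg (σ s.toNNReal ω + (SimpleProcess.sample σ hσa n).toProcess s.toNNReal ω)]
      _ = 2 * ENNReal.ofReal (σ s.toNNReal ω ^ 2) +
            2 * ENNReal.ofReal ((SimpleProcess.sample σ hσa n).toProcess s.toNNReal ω ^ 2) := by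
          rw [ENNReal.ofReal_add (by positivity) (by positivity), ENNReal.ofReal_mul zero_le_two,
            ENNReal.ofReal_mul zero_le_two, ENNReal.ofReal_ofNat]
      _ ≤ 2 * (⨆ r ∈ Set.Iic t, ENNReal.ofReal (σ r ω ^ 2)) + 2 * ⨆ r ∈ Set.Iic t, ENNReal.ofReal (σ r ω ^ 2) := by
          gcongr
      _ = 4 * ⨆ r ∈ Set.Iic t, ENNReal.ofReal (σ r ω ^ 2) := by ring
  have hsupm : AEMeasurable (fun ω => ⨆ s ∈ Set.Iic t, ENNReal.ofReal (σ s ω ^ 2)) μ :=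
    Literature.Analysis.FunctionSpaces.aemeasurable_biSup_Iic (Z := σ) (φ := fun x => ENNReal.ofReal (x ^ 2))
      (ENNReal.continuous_ofReal.comp (continuous_pow 2))
      (fun s => (hσa s).mono (𝓕.le s) le_rfl) hσc t
  have hGfin : ∫⁻ ω, G ω ∂μ ≠ ⊤ := by
    simp only [hG]
    rw [lintegral_mul_const'' _ (hsupm.const_mul _), lintegral_const_mul'' _ hsupm]
    exact ENNReal.mul_ne_top (ENNReal.mul_ne_top (by norm_num) (hσsup t).ne) measure_Icc_lt_top.ne
  have hlim : ∀ᵐ ω ∂μ, Tendsto (fun n => F n ω) atTop (𝓝 0) := by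
    filter_upwards [hσc] with ω hω
    exact SimpleProcess.tendsto_lintegral_sample_sub_sq σ hσa hω t
  have h := tendsto_lintegral_of_dominated_convergence G hFm hbound hGfin hlim
  simpa using h

/-- **The sampling-error martingale.**  For `J = ∫ σ dB` a square-integrable martingale Itô integral
(`σ` progressive) and the sampled step process `σₙ = sample σ n`: `Ĩ = J − σₙ·B` is a square-integrable
martingale, an Itô integral of `σ − σₙ`, with `E[sup_{s≤t} Ĩ_s²] ≤ 4 E∫₀ᵗ (σ − σₙ)²`. [folklore] -/
theorem samplingErr_facts [IsProbabilityMeasure μ] {B σ J : ℝ≥0 → Ω → ℝ}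
    (hB : Martingale B 𝓕 μ) (hBsq : Martingale (fun t ω => B t ω ^ 2 - (t : ℝ)) 𝓕 μ)
    (hB2 : ∀ t, MemLp (B t) 2 μ) (hBc : ∀ ω, Continuous (B · ω))
    (hσ : IsStronglyProgressive 𝓕 σ) (hσa : Adapted 𝓕 σ) (hJ : IsItoIntegral σ B J 𝓕 μ) (hJM : Martingale J 𝓕 μ)
    (hJ2 : ∀ t, MemLp (J t) 2 μ) (n : ℕ) :
    Martingale (fun t ω => J t ω - (SimpleProcess.sample σ hσa n).integral B t ω) 𝓕 μ ∧
      (∀ t, MemLp (fun ω => J t ω - (SimpleProcess.sample σ hσa n).integral B t ω) 2 μ) ∧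
      IsItoIntegral (fun t ω => σ t ω - (SimpleProcess.sample σ hσa n).toProcess t ω) B
        (fun t ω => J t ω - (SimpleProcess.sample σ hσa n).integral B t ω) 𝓕 μ ∧
      ∀ t : ℝ≥0, ∫⁻ ω, ⨆ s ∈ Set.Iic t, ENNReal.ofReal
          ((J s ω - (SimpleProcess.sample σ hσa n).integral B s ω) ^ 2) ∂μ ≤
        4 * sqErr σ (SimpleProcess.sample σ hσa n).toProcess μ t := by
  set K := SimpleProcess.sample σ hσa n with hK
  obtain ⟨hKI, hKM, hK2⟩ := simple_isItoIntegral_self K hB hBsq hB2 hBc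
  have hσpath : ∀ ω, Measurable fun s : ℝ => σ s.toNNReal ω := fun ω =>
    measurable_path_of_measurable_toNNReal (measurable_toNNReal_of_isStronglyProgressive hσ) ω
  have hKpath : ∀ ω, Measurable fun s : ℝ => K.toProcess s.toNNReal ω := fun ω =>
    K.measurable_toProcess_prod.comp measurable_prodMk_left
  refine ⟨hJM.sub hKM, fun t => (hJ2 t).sub (hK2 t), hJ.sub_of_martingale hKI hσpath hKpath hJM hKM, fun t => ?_⟩
  exact lintegral_iSup_sub_simple_sq_le hB hBsq hB2 hBc hσ hJ K t

/-- **Quadratic sums of the sampling-error martingale are small**: over any monotone grid `u` with `u M ≤ t`,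
`E Σ_{j<M} (Ĩ_{u_{j+1}} − Ĩ_{u_j})² ≤ E[Ĩ_{u_M}²] ≤ (4 E∫₀ᵗ (σ − σₙ)²)` (orthogonal increments). [folklore] -/
theorem integral_quadSum_samplingErr_le [IsProbabilityMeasure μ] {I : ℝ≥0 → Ω → ℝ}
    (hIM : Martingale I 𝓕 μ) (hI2 : ∀ t, MemLp (I t) 2 μ) {u : ℕ → ℝ≥0} (hu : Monotone u) (M : ℕ) :
    ∫ ω, ∑ j ∈ range M, (I (u (j + 1)) ω - I (u j) ω) ^ 2 ∂μ ≤ ∫ ω, I (u M) ω ^ 2 ∂μ := by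
  rw [integral_quadSum_of_martingale hIM hI2 (fun i _ => hu (Nat.le_succ i))]
  linarith [integral_nonneg (μ := μ) (f := fun ω => I (u 0) ω ^ 2) fun ω => sq_nonneg _]

/-- From the `L²(sup)` bound in `ℝ≥0∞` to a real second-moment bound at a fixed time. [folklore] -/
theorem integral_sq_le_of_lintegral_iSup_le [IsProbabilityMeasure μ] {I : ℝ≥0 → Ω → ℝ} {t : ℝ≥0}
    (hI2 : MemLp (I t) 2 μ) {A : ℝ≥0∞} (hA : A ≠ ⊤)
    (h : ∫⁻ ω, ⨆ s ∈ Set.Iic t, ENNReal.ofReal (I s ω ^ 2) ∂μ ≤ A) :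
    ∫ ω, I t ω ^ 2 ∂μ ≤ A.toReal := by
  have h1 : ∫⁻ ω, ENNReal.ofReal (I t ω ^ 2) ∂μ ≤ A :=
    (lintegral_mono fun ω => le_iSup₂_of_le t (Set.mem_Iic.2 le_rfl) le_rfl).trans h
  rw [integral_eq_lintegral_of_nonneg_ae (ae_of_all _ fun ω => sq_nonneg _) (hI2.integrable_sq.aestronglyMeasurable)]
  exact ENNReal.toReal_mono hA h1

end Summit.QuantumFields.YangMills.Theorems.ColdStartUniversality

end
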